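import Summits.Ventures.Crystal3D.Bulk.GapSubHullRotation
import Summits.Ventures.Crystal3D.Bulk.GapHullConnected
import HarnessLib

/-!
# Counts, Euler's relation and connectedness of the oriented tight map inside the hull fan of
# ANY admissible ambient direction set (route 1 of `HOME/lean/lemmaL/DESIGN.md`, step R1.3)

HONEST FRAMING. Part of the venture `Summits/Ventures/Crystal3D` (cell `pub-crystal3d`, phase 2;
seat p3). Kernel lemmas about an admissible fourteen-ball configuration `c` with
`intruderDist c < 3/2`; nothing here asserts anything about GAP(1.26). This is the `X`-generic
form of `Bulk/GapHullEuler.lean` / `Bulk/GapHullConnected.lean` (written there for the full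
direction set `dirSet c`), for an arbitrary finite ambient `X ⊂ S²` with `0` interior to its hull
and every tight dart a hull dart of `X` (hypotheses `hX1`, `h0`, `hT`), on top of
`Bulk/GapSubHullRotation.lean` (`tightDartsIn c X`, `induce σ_H = onextNbr`, `φ = ofaceSucc`):

* the counts of the induced system: `#tightDartsIn = #darts c`, `numV = #activeVertices c`,
  `numF = onumFaces c`;
* **`IsGapConfig.oriented_euler_of`**: `2·#activeVertices c − #darts c + 2·onumFaces c = 4·k`
  with `k = numK` of the tight darts inside the hull system of `X` (sub-systems of the planar
  hull map are planar, typer-bulk-2's `chi2_eq_of_subset`);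
* connectedness: `conn` lemmas, **`IsGapConfig.numK_eq_one_iff_tightConnected_of`** — `k = 1`
  iff `TightConnected c` (hence `k = 1` at every census configuration,
  `CensusRows.tightConnected`; Euler then reads `V′ − E + F° = 2`, `Bulk/GapHullConnected.lean`).
-/

noncomputable section

namespace Summit.Ventures.Crystal3D

open Literature.Geometry.DiscreteGeometry Finset Equiv HullRotSys

variable {c : Fin 14 → EuclideanSpace ℝ (Fin 3)} {X : Finset (EuclideanSpace ℝ (Fin 3))}

section Ambient

variable (hc : IsGapConfig c) (hD : intruderDist c < 3 / 2) (hX1 : ∀ y ∈ X, ‖y‖ = 1)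
  (h0 : (0 : EuclideanSpace ℝ (Fin 3)) ∈ interior (convexHull ℝ (X : Set _)))
  (hT : ∀ q ∈ darts c, dirPair c q ∈ hullDarts X)

/-! ## The counts of the induced system -/

include hc hD hT in
/-- The number of tight darts in the dart type is the number of darts. -/
theorem IsGapConfig.card_tightDartsIn_of : (tightDartsIn c X).card = (darts c).card := by
  have hD2 : intruderDist c < 2 := by linarith
  have himg : (tightDartsIn c X).image Subtype.val = (darts c).image (dirPair c) := by
    ext p
    rw [mem_image, mem_image]
    constructor
    · rintro ⟨d, hd, rfl⟩
      obtain ⟨q, hq, hqd⟩ := mem_tightDartsIn.1 hd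
      exact ⟨q, hq, hqd⟩
    · rintro ⟨q, hq, rfl⟩
      exact ⟨⟨dirPair c q, hT q hq⟩, mem_tightDartsIn.2 ⟨q, hq, rfl⟩, rfl⟩
  rw [← card_image_of_injective (tightDartsIn c X) Subtype.val_injective, himg,
    card_image_of_injOn (hc.dirPair_injOn hD2)]

include hc hD hT in
/-- **`V = #activeVertices`** for the induced system. -/
theorem IsGapConfig.numV_tightDartsIn_of :
    RotSys.numV (rot hX1 h0) (tightDartsIn c X) = (activeVertices c).card := by
  classical
  have hD2 : intruderDist c < 2 := by linarith
  unfold RotSys.numV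
  rw [numClasses_eq_card_image (fun d : ↥(hullDarts X) => d.1.1)
    (fun d _ d' _ => sameCycle_rot_iff d d')]
  have himg : (tightDartsIn c X).image (fun d : ↥(hullDarts X) => d.1.1) =
      ((darts c).image Prod.fst).image (gapDir c) := by
    ext y
    simp only [mem_image]
    constructor
    · rintro ⟨d, hd, rfl⟩
      obtain ⟨q, hq, hqd⟩ := mem_tightDartsIn.1 hd
      exact ⟨q.1, ⟨q, hq, rfl⟩, by rw [← hqd]; rfl⟩
    · rintro ⟨i, ⟨q, hq, rfl⟩, rfl⟩
      exact ⟨⟨dirPair c q, hT q hq⟩, mem_tightDartsIn.2 ⟨q, hq, rfl⟩, rfl⟩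
  rw [himg, card_image_of_injOn, image_fst_darts]
  intro i hi i' hi' h
  rw [Finset.mem_coe, mem_image] at hi hi'
  obtain ⟨q, hq, rfl⟩ := hi
  obtain ⟨q', hq', rfl⟩ := hi'
  exact hc.eq_of_gapDir_eq hD2 (mem_darts.1 hq).1 (mem_darts.1 hq').1 h

include hc hD hT in
/-- **`F = onumFaces`** for the induced system. -/
theorem IsGapConfig.numF_tightDartsIn_of :
    RotSys.numF (rot hX1 h0) (inv X) (tightDartsIn c X) = onumFaces c := by
  classical
  have hD2 : intruderDist c < 2 := by linarith
  -- the face label of a dart: the oriented face of its index pair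
  set f : ↥(hullDarts X) → Finset (Fin 14 × Fin 14) := fun d =>
    if h : ∃ q ∈ darts c, dirPair c q = d.1 then ofaceOf c (Classical.choose h) else ∅ with hf
  have hfq : ∀ {q : Fin 14 × Fin 14} (hq : q ∈ darts c) {d : ↥(hullDarts X)},
      dirPair c q = d.1 → f d = ofaceOf c q := by
    intro q hq d hd
    have h : ∃ q ∈ darts c, dirPair c q = d.1 := ⟨q, hq, hd⟩
    have hval : f d = ofaceOf c (Classical.choose h) := by rw [hf]; exact dif_pos h
    obtain ⟨hq₀, hd₀⟩ := Classical.choose_spec h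
    have heq : Classical.choose h = q :=
      hc.dirPair_injOn hD2 (Finset.mem_coe.2 hq₀) (Finset.mem_coe.2 hq) (hd₀.trans hd.symm)
    rw [hval, heq]
  unfold RotSys.numF
  rw [numClasses_eq_card_image f ?_]
  · unfold onumFaces ofaces
    congr 1
    ext F
    rw [mem_image, mem_image]
    constructor
    · rintro ⟨d, hd, rfl⟩
      obtain ⟨q, hq, hqd⟩ := mem_tightDartsIn.1 hd
      exact ⟨q, hq, (hfq hq hqd).symm⟩
    · rintro ⟨q, hq, rfl⟩
      exact ⟨⟨dirPair c q, hT q hq⟩, mem_tightDartsIn.2 ⟨q, hq, rfl⟩, hfq hq rfl⟩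
  · intro d hd d' hd'
    obtain ⟨q, hq, hqd⟩ := mem_tightDartsIn.1 hd
    obtain ⟨q', hq', hqd'⟩ := mem_tightDartsIn.1 hd'
    rw [hfq hq hqd, hfq hq' hqd']
    exact hc.sameCycle_phi_iff_ofaceOf_of hD hX1 h0 hT hq hq' hqd.symm hqd'.symm

/-! ## Euler's relation for the oriented tight map, in any ambient fan -/

include hc hD hT in
/-- **Euler's relation for the ORIENTED tight map, read in the hull fan of `X`.**
`2·#activeVertices c − #darts c + 2·onumFaces c = 4·k`, `k` the number of connected components
of the tight darts as a sub-rotation-system of the hull rotation system of `X`. -/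
theorem IsGapConfig.oriented_euler_of :
    2 * ((activeVertices c).card : ℤ) - (darts c).card + 2 * (onumFaces c : ℤ) =
      4 * (RotSys.numK (rot hX1 h0) (inv X) (tightDartsIn c X) : ℤ) := by
  have hplanar := chi2_univ_eq_numK (hX1 := hX1) (h0 := h0)
  have h := (isRotSys (hX1 := hX1) (h0 := h0)).chi2_eq_of_subset
    (fun _ _ => mem_univ _) (isClosed_tightDartsIn c X) (subset_univ _) hplanar
  unfold RotSys.chi2 at h
  rw [← hc.numV_tightDartsIn_of hD hX1 h0 hT, ← hc.card_tightDartsIn_of hD hT,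
    ← hc.numF_tightDartsIn_of hD hX1 h0 hT]
  exact h

/-! ## Connectedness -/

include hc in
/-- Tight darts with the same tail are `conn`-related (one vertex cycle of `σ_H`). -/
theorem IsGapConfig.conn_tight_of_fst_eq_of {q q' : Fin 14 × Fin 14} (hq : q ∈ darts c)
    (hq' : q' ∈ darts c) (h : q.1 = q'.1) {d d' : ↥(hullDarts X)} (hd : d.1 = dirPair c q)
    (hd' : d'.1 = dirPair c q') :
    RotSys.conn (rot hX1 h0) (inv X) (tightDartsIn c X) d d' := by
  have _ := hc
  refine RotSys.conn_of_sameCycle (mem_tightDartsIn.2 ⟨q, hq, hd.symm⟩)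
    (mem_tightDartsIn.2 ⟨q', hq', hd'.symm⟩) ?_
  rw [sameCycle_rot_iff, hd, hd']
  show gapDir c q.1 = gapDir c q'.1
  rw [h]

/-- The reversed tight dart is connected to the dart. -/
theorem conn_tight_swap_of {q : Fin 14 × Fin 14} (hq : q ∈ darts c) {d d' : ↥(hullDarts X)}
    (hd : d.1 = dirPair c q) (hd' : d'.1 = dirPair c q.swap) :
    RotSys.conn (rot hX1 h0) (inv X) (tightDartsIn c X) d d' := by
  have hdT : d ∈ tightDartsIn c X := mem_tightDartsIn.2 ⟨q, hq, hd.symm⟩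
  have h := RotSys.conn_alpha (σ := rot hX1 h0) (isClosed_tightDartsIn c X) hdT
  have he : inv X d = d' := by
    apply Subtype.ext
    rw [inv_apply_val, hd, hd', dirPair_swap]
  rw [he] at h
  exact h

include hc hT in
/-- **Under `TightConnected`, any two tight darts are connected** in the induced system. -/
theorem IsGapConfig.conn_tight_of_tightConnected_of (hconn : TightConnected c)
    {d d' : ↥(hullDarts X)} (hd : d ∈ tightDartsIn c X) (hd' : d' ∈ tightDartsIn c X) :
    RotSys.conn (rot hX1 h0) (inv X) (tightDartsIn c X) d d' := by
  classical
  obtain ⟨q₀, hq₀, hq₀d⟩ := mem_tightDartsIn.1 hd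
  obtain ⟨q', hq', hq'd⟩ := mem_tightDartsIn.1 hd'
  -- the tails of the tight darts connected to `d`
  set A : Finset (Fin 14) := ((darts c).filter fun q => ∃ e ∈ tightDartsIn c X,
      e.1 = dirPair c q ∧ RotSys.conn (rot hX1 h0) (inv X) (tightDartsIn c X) d e).image
    Prod.fst with hA
  have hmemA : ∀ {i : Fin 14}, i ∈ A ↔ ∃ q ∈ darts c, q.1 = i ∧ ∃ e ∈ tightDartsIn c X,
      e.1 = dirPair c q ∧ RotSys.conn (rot hX1 h0) (inv X) (tightDartsIn c X) d e := by
    intro i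
    rw [hA, mem_image]
    constructor
    · rintro ⟨q, hq, rfl⟩
      rw [mem_filter] at hq
      exact ⟨q, hq.1, rfl, hq.2⟩
    · rintro ⟨q, hq, rfl, he⟩
      exact ⟨q, mem_filter.2 ⟨hq, he⟩, rfl⟩
  have hAsub : A ⊆ activeVertices c := by
    intro i hi
    obtain ⟨q, hq, rfl, -⟩ := hmemA.1 hi
    rw [← image_fst_darts]; exact mem_image_of_mem _ hq
  have hAne : A.Nonempty :=
    ⟨q₀.1, hmemA.2 ⟨q₀, hq₀, rfl, d, hd, hq₀d.symm, RotSys.conn_refl _ _ _ _⟩⟩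
  have hAcl : ∀ i ∈ A, ∀ j : Fin 14, (i, j) ∈ darts c → j ∈ A := by
    intro i hi j hij
    obtain ⟨q₁, hq₁, hq₁i, e₁, he₁, he₁q, hc₁⟩ := hmemA.1 hi
    set e : ↥(hullDarts X) := ⟨dirPair c (i, j), hT _ hij⟩ with he
    set e' : ↥(hullDarts X) := ⟨dirPair c (j, i), hT _ (swap_mem_darts hij)⟩ with he'
    have h1 : RotSys.conn (rot hX1 h0) (inv X) (tightDartsIn c X) e₁ e :=
      hc.conn_tight_of_fst_eq_of hX1 h0 hq₁ hij hq₁i he₁q rfl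
    have h2 : RotSys.conn (rot hX1 h0) (inv X) (tightDartsIn c X) e e' :=
      conn_tight_swap_of hX1 h0 hij rfl rfl
    exact hmemA.2 ⟨(j, i), swap_mem_darts hij, rfl, e', mem_tightDartsIn.2 ⟨(j, i),
      swap_mem_darts hij, rfl⟩, rfl, RotSys.conn_trans (RotSys.conn_trans hc₁ h1) h2⟩
  have hAall : A = activeVertices c := hconn A hAsub hAne hAcl
  have hq'1 : q'.1 ∈ A := by
    rw [hAall, ← image_fst_darts]; exact mem_image_of_mem _ hq'
  obtain ⟨q₂, hq₂, hq₂1, e₂, he₂, he₂q, hc₂⟩ := hmemA.1 hq'1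
  exact RotSys.conn_trans hc₂ (hc.conn_tight_of_fst_eq_of hX1 h0 hq₂ hq' hq₂1 he₂q hq'd.symm)

include hc hT in
/-- **`k = 1` under `TightConnected`** (for a configuration with at least one tight pair). -/
theorem IsGapConfig.numK_eq_one_of_tightConnected_of (hconn : TightConnected c)
    (hne : (darts c).Nonempty) : RotSys.numK (rot hX1 h0) (inv X) (tightDartsIn c X) = 1 := by
  classical
  unfold RotSys.numK
  rw [numClasses_eq_card_image (fun _ : ↥(hullDarts X) => (0 : ℕ))
    (fun d hd d' hd' => iff_of_true (hc.conn_tight_of_tightConnected_of hX1 h0 hT hconn hd hd')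
      rfl)]
  obtain ⟨q, hq⟩ := hne
  have hTne : (tightDartsIn c X).Nonempty :=
    ⟨⟨dirPair c q, hT q hq⟩, mem_tightDartsIn.2 ⟨q, hq, rfl⟩⟩
  rw [image_const hTne, card_singleton]

include hc hD in
/-- Along `conn`, membership of the tail in a set closed under tight adjacency is invariant. -/
theorem IsGapConfig.tail_mem_iff_of_conn_of {A : Finset (Fin 14)}
    (hAcl : ∀ i ∈ A, ∀ j : Fin 14, (i, j) ∈ darts c → j ∈ A) {x y : ↥(hullDarts X)}
    (h : RotSys.conn (rot hX1 h0) (inv X) (tightDartsIn c X) x y) :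
    (∀ q ∈ darts c, dirPair c q = x.1 → q.1 ∈ A) ↔ (∀ q ∈ darts c, dirPair c q = y.1 → q.1 ∈ A)
        := by
  have hD2 : intruderDist c < 2 := by linarith
  have key : ∀ {z : ↥(hullDarts X)} {q : Fin 14 × Fin 14}, q ∈ darts c →
      dirPair c q = z.1 → ((∀ q' ∈ darts c, dirPair c q' = z.1 → q'.1 ∈ A) ↔ q.1 ∈ A) := by
    intro z q hq hqz
    constructor
    · exact fun hall => hall q hq hqz
    · intro hq1 q' hq' hq'z
      have : q' = q := hc.dirPair_injOn hD2 (Finset.mem_coe.2 hq') (Finset.mem_coe.2 hq)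
        (hq'z.trans hqz.symm)
      rw [this]; exact hq1
  induction h with
  | rel x y hxy =>
    obtain ⟨hx, hy, hadj⟩ := hxy
    obtain ⟨qx, hqx, hqxe⟩ := mem_tightDartsIn.1 hx
    obtain ⟨qy, hqy, hqye⟩ := mem_tightDartsIn.1 hy
    rw [key hqx hqxe, key hqy hqye]
    rcases hadj with hcyc | hal
    · rw [sameCycle_rot_iff, ← hqxe, ← hqye] at hcyc
      have : qx.1 = qy.1 :=
        hc.eq_of_gapDir_eq hD2 (mem_darts.1 hqx).1 (mem_darts.1 hqy).1 hcyc
      rw [this]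
    · have hval : dirPair c qy = dirPair c qx.swap := by
        rw [hqye, hal, inv_apply_val, ← hqxe, dirPair_swap]
      have hq : qy = qx.swap :=
        hc.dirPair_injOn hD2 (Finset.mem_coe.2 hqy) (Finset.mem_coe.2 (swap_mem_darts hqx)) hval
      rw [hq]
      constructor
      · exact fun h1 => hAcl _ h1 _ hqx
      · exact fun h2 => hAcl _ h2 _ (swap_mem_darts hqx)
  | refl x => exact Iff.rfl
  | symm x y _ ih => exact ih.symm
  | trans x y z _ _ ih1 ih2 => exact ih1.trans ih2

include hc hD hT in
/-- **One component ⇒ the tight graph is connected.** -/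
theorem IsGapConfig.tightConnected_of_numK_eq_one_of
    (hk : RotSys.numK (rot hX1 h0) (inv X) (tightDartsIn c X) = 1) : TightConnected c := by
  intro A hAsub hAne hAcl
  refine Subset.antisymm hAsub fun i hi => ?_
  obtain ⟨i₀, hi₀⟩ := hAne
  obtain ⟨hi₀0, j₀, hj₀⟩ := mem_activeVertices.1 (hAsub hi₀)
  obtain ⟨hi0, j, hj⟩ := mem_activeVertices.1 hi
  have hq₀ : (i₀, j₀) ∈ darts c := mk_mem_darts hi₀0 hj₀
  have hq : (i, j) ∈ darts c := mk_mem_darts hi0 hj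
  set d₀ : ↥(hullDarts X) := ⟨dirPair c (i₀, j₀), hT _ hq₀⟩
  set d : ↥(hullDarts X) := ⟨dirPair c (i, j), hT _ hq⟩
  have hconn : RotSys.conn (rot hX1 h0) (inv X) (tightDartsIn c X) d₀ d :=
    rel_of_numClasses_eq_one (fun x _ => RotSys.conn_refl _ _ _ x) hk
      (mem_tightDartsIn.2 ⟨(i₀, j₀), hq₀, rfl⟩) (mem_tightDartsIn.2 ⟨(i, j), hq, rfl⟩)
  have hiff := hc.tail_mem_iff_of_conn_of hD hX1 h0 hAcl hconn
  have hD2 : intruderDist c < 2 := by linarith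
  have hP0 : ∀ q ∈ darts c, dirPair c q = d₀.1 → q.1 ∈ A := by
    intro q hq' hqe
    have : q = (i₀, j₀) :=
      hc.dirPair_injOn hD2 (Finset.mem_coe.2 hq') (Finset.mem_coe.2 hq₀) hqe
    rw [this]; exact hi₀
  exact hiff.1 hP0 (i, j) hq rfl

include hc hD hT in
/-- **`k = 1` iff the tight graph is connected**, in any ambient fan (configuration with a
tight pair). -/
theorem IsGapConfig.numK_eq_one_iff_tightConnected_of (hne : (darts c).Nonempty) :
    RotSys.numK (rot hX1 h0) (inv X) (tightDartsIn c X) = 1 ↔ TightConnected c :=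
  ⟨hc.tightConnected_of_numK_eq_one_of hD hX1 h0 hT,
    fun h => hc.numK_eq_one_of_tightConnected_of hX1 h0 hT h hne⟩

end Ambient

end Summit.Ventures.Crystal3D
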